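import Literature.FieldTheory.Regular.RegularExtension
import Literature.NumberTheory.DiophantineGeometry.CafureMatera
import Mathlib.FieldTheory.Minpoly.IsIntegrallyClosed
import Mathlib.RingTheory.Polynomial.IsIntegral
import Mathlib.RingTheory.Polynomial.UniqueFactorization
import Mathlib.RingTheory.Localization.Integer
import Mathlib.Algebra.MvPolynomial.Equiv
import Mathlib.Algebra.MvPolynomial.Nilpotent
import Mathlib.RingTheory.AlgebraicIndependent.Basic
import HarnessLib

/-!
# The hypersurface model of a point over a relatively algebraically closed field

Topic `Literature/AlgebraicGeometry/Motives`; a step of the elementary proof of the two-point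
curve lemma (`Motives/CurveThroughTwoPoints`, `mumford_smoothCurve_through_two_points`; Mumford,
*Abelian Varieties*, §6). Setting: `R` an integrally closed domain with fraction field `L` of
characteristic `0`, `E ⊇ L` a field in which `L` is relatively algebraically closed, `x₁, …, x_m ∈ E`
algebraically independent over `L`, and `y ∈ E` integral over `R[x]`. Then the point
`β = (y, x₁, …, x_m)` of `E^{m+1}` has a defining equation over `R`: there is
`F ∈ R[X₀, X₁, …, X_m]`, MONIC of degree `d ≥ 1` in `X₀` (through Mathlib's
`MvPolynomial.finSuccEquiv`), with

* `ker (R[X] → E, X ↦ β) = (F)` and `ker (L[X] → E, X ↦ β) = (F_L)` — `F` is the minimal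
  polynomial of `y` over the integrally closed domain `R[x₁, …, x_m]`
  (`minpoly.isIntegrallyClosed_dvd`), and denominators clear over `L`;
* `F_L` is ABSOLUTELY IRREDUCIBLE: the prime ideal of the point `β` over the relatively
  algebraically closed `L` stays prime over `L̄` (the tree's
  `Literature.FieldTheory.Regular.isPrime_map_ker_aeval`, Lang *Algebra* VIII §4), and it is
  principal, generated by `F_L`;
* every specialisation `F^π` along `π : R → k` is again monic of degree `d` in `X₀`.

Main statement: `exists_hypersurfaceModel`. Also: `isIntegrallyClosed_mvPolynomial`
(`R[X₁, …, X_m]` is integrally closed), `finSuccEquiv_map` (naturality of `finSuccEquiv`),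
`exists_map_eq_smul` (clearing denominators in `L[X]`), `irreducible_of_isAbsIrreducible`.
Everything is proved; no named facts.

## References

* S. Lang, *Algebra*, 3rd ed. (2002), VIII §4 (regular extensions). [Lang2002]
* D. Mumford, *Abelian Varieties* (1970), §6, Lemma. [MumfordAV1970]
-/

noncomputable section

open MvPolynomial

namespace Literature.AlgebraicGeometry.Motives

namespace TwoPointPencil

open Literature.NumberTheory.DiophantineGeometry (IsAbsIrreducible)
open Literature.FieldTheory.Regular (isPrime_map_ker_aeval)

universe u

/-! ### Generalities on `finSuccEquiv`, integrally closed polynomial rings, denominators -/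

/-- **`R[X₁, …, X_m]` is integrally closed** for an integrally closed domain `R` (induction on
`m` through `R[X₀, …, X_m] ≅ R[X₁, …, X_m][X₀]` and Mathlib's instance for `R[X]`). [folklore] -/
theorem isIntegrallyClosed_mvPolynomial {R : Type u} [CommRing R] [IsDomain R]
    [IsIntegrallyClosed R] : ∀ m : ℕ, IsIntegrallyClosed (MvPolynomial (Fin m) R)
  | 0 => IsIntegrallyClosed.of_equiv (MvPolynomial.isEmptyAlgEquiv R (Fin 0)).symm.toRingEquiv
  | m + 1 => by
    haveI := isIntegrallyClosed_mvPolynomial (R := R) m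
    exact IsIntegrallyClosed.of_equiv (MvPolynomial.finSuccEquiv R m).symm.toRingEquiv

/-- **Naturality of `finSuccEquiv`** in the coefficient ring. [folklore] -/
theorem finSuccEquiv_map {R S : Type*} [CommSemiring R] [CommSemiring S] (f : R →+* S) (n : ℕ)
    (p : MvPolynomial (Fin (n + 1)) R) :
    finSuccEquiv S n (MvPolynomial.map f p) =
      Polynomial.map (MvPolynomial.map f) (finSuccEquiv R n p) := by
  ext i m
  rw [finSuccEquiv_coeff_coeff, coeff_map, Polynomial.coeff_map, coeff_map,
    finSuccEquiv_coeff_coeff]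

/-- Evaluation at `(y, x)` factors through `finSuccEquiv`: `p(y, x) = (finSuccEquiv p)(x)(y)`.
[folklore] -/
theorem aeval_cons_eq_aevalTower {R : Type*} [CommRing R] {E : Type*} [CommRing E] [Algebra R E]
    {n : ℕ} (x : Fin n → E) (y : E) (p : MvPolynomial (Fin (n + 1)) R) :
    MvPolynomial.aeval (Fin.cons y x : Fin (n + 1) → E) p =
      Polynomial.aevalTower (MvPolynomial.aeval x : MvPolynomial (Fin n) R →ₐ[R] E) y
        (finSuccEquiv R n p) := by
  change _ = ((Polynomial.aevalTower (MvPolynomial.aeval x : MvPolynomial (Fin n) R →ₐ[R] E) y).comp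
    (finSuccEquiv R n).toAlgHom) p
  congr 1
  apply MvPolynomial.algHom_ext
  intro i
  refine Fin.cases ?_ ?_ i
  · simp [finSuccEquiv_X_zero]
  · intro j
    simp [finSuccEquiv_X_succ]

/-- **Clearing denominators** of a polynomial over the fraction field: `r • p = P_L` for some
`r ∈ R ∖ {0}` and `P ∈ R[X]`. [folklore] -/
theorem exists_map_eq_smul {R : Type u} [CommRing R] [IsDomain R] {L : Type u} [Field L]
    [Algebra R L] [IsFractionRing R L] {σ : Type*} (p : MvPolynomial σ L) :
    ∃ (r : R) (P : MvPolynomial σ R), r ≠ 0 ∧ MvPolynomial.map (algebraMap R L) P = r • p := by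
  classical
  obtain ⟨b, hb⟩ := IsLocalization.exist_integer_multiples (nonZeroDivisors R) p.support
    (fun s => p.coeff s)
  choose! a ha using hb
  refine ⟨b, ∑ s ∈ p.support, monomial s (a s), nonZeroDivisors.coe_ne_zero b, ?_⟩
  rw [map_sum]
  conv_rhs => rw [p.as_sum, Finset.smul_sum]
  refine Finset.sum_congr rfl fun s hs => ?_
  rw [map_monomial, ha s hs, smul_monomial]

/-- **An absolutely irreducible polynomial is irreducible.** [folklore] -/
theorem irreducible_of_isAbsIrreducible {k : Type*} [Field k] {N : ℕ} {f : MvPolynomial (Fin N) k}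
    (hf : IsAbsIrreducible f) : Irreducible f := by
  have hinj : Function.Injective (algebraMap k (AlgebraicClosure k)) := (algebraMap k _).injective
  have hmapinj : Function.Injective (MvPolynomial.map (σ := Fin N) (algebraMap k (AlgebraicClosure k))) :=
    map_injective _ hinj
  unfold IsAbsIrreducible at hf
  refine ⟨fun hu => hf.not_isUnit (hu.map _), fun a b hab => ?_⟩
  have hab' := hf.isUnit_or_isUnit (a := MvPolynomial.map (algebraMap k _) a)
    (b := MvPolynomial.map (algebraMap k _) b) (by rw [hab, map_mul])
  -- a unit of `k̄[X]` coming from `k[X]` is a unit of `k[X]`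
  have key : ∀ c : MvPolynomial (Fin N) k,
      IsUnit (MvPolynomial.map (algebraMap k (AlgebraicClosure k)) c) → IsUnit c := by
    intro c hc
    rw [MvPolynomial.isUnit_iff_totalDegree_of_isReduced] at hc ⊢
    refine ⟨?_, ?_⟩
    · rw [coeff_map] at hc
      rcases eq_or_ne (c.coeff 0) 0 with h0 | h0
      · rw [h0, map_zero] at hc
        exact absurd hc.1 not_isUnit_zero
      · exact isUnit_iff_ne_zero.mpr h0
    · have : (MvPolynomial.map (algebraMap k (AlgebraicClosure k)) c).totalDegree = c.totalDegree := by
        simp only [totalDegree, support_map_of_injective c hinj]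
      rw [← this]
      exact hc.2
  exact hab'.imp (key a) (key b)

/-! ### The model -/

variable {R : Type u} [CommRing R] [IsDomain R] [IsIntegrallyClosed R]
  {L : Type u} [Field L] [CharZero L] [Algebra R L] [IsFractionRing R L]
  {E : Type u} [Field E] [Algebra L E] [Algebra R E] [IsScalarTower R L E]

/-- **The hypersurface model.** Let `R` be an integrally closed domain with fraction field `L`
(characteristic `0`), `E ⊇ L` a field with `L` relatively algebraically closed in `E`,
`x : Fin m → E` algebraically independent over `L`, and `y ∈ E` a root of a monic polynomial
`q` over `R[x₁, …, x_m]`. Then there are `F ∈ R[X₀, …, X_m]` and `d ≥ 1` such that `F` is monic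
of degree `d` in `X₀` (i.e. `finSuccEquiv R m F` is monic of degree `d`), the kernel of
`X ↦ (y, x) : R[X₀, …, X_m] → E` is `(F)`, the kernel of `L[X₀, …, X_m] → E` is `(F_L)`, and
`F_L` is absolutely irreducible. (`F` = the minimal polynomial of `y` over the integrally closed
domain `R[x]`; absolute irreducibility from `isPrime_map_ker_aeval`.)
[cite: Lang2002, VIII §4] -/
theorem exists_hypersurfaceModel
    (hrac : ∀ z : E, IsAlgebraic L z → z ∈ Set.range (algebraMap L E))
    {m : ℕ} (x : Fin m → E) (hx : AlgebraicIndependent L x) (y : E)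
    (q : Polynomial (MvPolynomial (Fin m) R)) (hqm : q.Monic)
    (hqy : Polynomial.aevalTower (MvPolynomial.aeval x : MvPolynomial (Fin m) R →ₐ[R] E) y q = 0) :
    ∃ (F : MvPolynomial (Fin (m + 1)) R) (d : ℕ), 1 ≤ d ∧
      (finSuccEquiv R m F).Monic ∧ (finSuccEquiv R m F).natDegree = d ∧
      RingHom.ker (MvPolynomial.aeval (Fin.cons y x : Fin (m + 1) → E) :
          MvPolynomial (Fin (m + 1)) R →ₐ[R] E) = Ideal.span {F} ∧
      RingHom.ker (MvPolynomial.aeval (Fin.cons y x : Fin (m + 1) → E) :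
          MvPolynomial (Fin (m + 1)) L →ₐ[L] E) =
        Ideal.span {MvPolynomial.map (algebraMap R L) F} ∧
      IsAbsIrreducible (MvPolynomial.map (algebraMap R L) F) := by
  classical
  -- `S = R[x₁, …, x_m]` acting on `E` through `x`
  let φ : MvPolynomial (Fin m) R →ₐ[R] E := MvPolynomial.aeval x
  letI algSE : Algebra (MvPolynomial (Fin m) R) E := φ.toRingHom.toAlgebra
  have halg : ∀ s : MvPolynomial (Fin m) R, algebraMap (MvPolynomial (Fin m) R) E s = φ s :=
    fun _ => rfl
  haveI : IsScalarTower R (MvPolynomial (Fin m) R) E := IsScalarTower.of_algebraMap_eq fun r => by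
    rw [halg, AlgHom.commutes]
  -- `φ` is injective (`x` is algebraically independent over `L ⊇ R`)
  have hφinj : Function.Injective φ := by
    have h1 : (MvPolynomial.aeval x : MvPolynomial (Fin m) L →ₐ[L] E).toRingHom.comp
        (MvPolynomial.map (algebraMap R L)) = φ.toRingHom := by
      apply MvPolynomial.ringHom_ext
      · intro r
        simp only [RingHom.coe_comp, Function.comp_apply, MvPolynomial.map_C,
          AlgHom.toRingHom_eq_coe, RingHom.coe_coe, MvPolynomial.aeval_C, φ]
        exact (IsScalarTower.algebraMap_apply R L E r).symm
      · intro i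
        simp only [RingHom.coe_comp, Function.comp_apply, MvPolynomial.map_X,
          AlgHom.toRingHom_eq_coe, RingHom.coe_coe, MvPolynomial.aeval_X, φ]
    have h2 : Function.Injective ((MvPolynomial.aeval x : MvPolynomial (Fin m) L →ₐ[L] E).toRingHom.comp
        (MvPolynomial.map (algebraMap R L))) :=
      (algebraicIndependent_iff_injective_aeval.mp hx).comp
        (map_injective _ (IsFractionRing.injective R L))
    rw [h1] at h2
    exact h2
  haveI : FaithfulSMul (MvPolynomial (Fin m) R) E :=
    (faithfulSMul_iff_algebraMap_injective (MvPolynomial (Fin m) R) E).mpr hφinj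
  haveI : IsIntegrallyClosed (MvPolynomial (Fin m) R) := isIntegrallyClosed_mvPolynomial m
  -- `y` is integral over `S`; its minimal polynomial `μ`
  have haT : ∀ p : Polynomial (MvPolynomial (Fin m) R),
      Polynomial.aevalTower φ y p = Polynomial.aeval y p := by
    intro p
    rw [Polynomial.aeval_def]
    rfl
  have hyint : IsIntegral (MvPolynomial (Fin m) R) y :=
    ⟨q, hqm, by rw [← Polynomial.aeval_def, ← haT]; exact hqy⟩
  set μ : Polynomial (MvPolynomial (Fin m) R) := minpoly (MvPolynomial (Fin m) R) y with hμ
  have hμm : μ.Monic := minpoly.monic hyint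
  have hμy : Polynomial.aeval y μ = 0 := minpoly.aeval (MvPolynomial (Fin m) R) y
  set F : MvPolynomial (Fin (m + 1)) R := (finSuccEquiv R m).symm μ with hF
  have hFμ : finSuccEquiv R m F = μ := (finSuccEquiv R m).apply_symm_apply μ
  -- the kernel over `R`
  have hkerR : RingHom.ker (MvPolynomial.aeval (Fin.cons y x : Fin (m + 1) → E) :
      MvPolynomial (Fin (m + 1)) R →ₐ[R] E) = Ideal.span {F} := by
    apply le_antisymm
    · intro p hp
      have hp' : MvPolynomial.aeval (Fin.cons y x : Fin (m + 1) → E) p = 0 := hp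
      rw [aeval_cons_eq_aevalTower, haT] at hp'
      obtain ⟨r, hr⟩ := minpoly.isIntegrallyClosed_dvd hyint hp'
      rw [Ideal.mem_span_singleton]
      refine ⟨(finSuccEquiv R m).symm r, ?_⟩
      apply (finSuccEquiv R m).injective
      rw [map_mul, hFμ, (finSuccEquiv R m).apply_symm_apply, ← hr]
    · rw [Ideal.span_le, Set.singleton_subset_iff, SetLike.mem_coe, RingHom.mem_ker]
      rw [aeval_cons_eq_aevalTower, hFμ, haT]
      exact hμy
  -- the kernel over `L` (clear denominators)
  set G := MvPolynomial.map (algebraMap R L) F with hG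
  have haevalmap : ∀ P : MvPolynomial (Fin (m + 1)) R,
      MvPolynomial.aeval (Fin.cons y x : Fin (m + 1) → E) (MvPolynomial.map (algebraMap R L) P) =
        MvPolynomial.aeval (Fin.cons y x : Fin (m + 1) → E) P := fun P =>
    MvPolynomial.aeval_map_algebraMap L _ P
  have hkerL : RingHom.ker (MvPolynomial.aeval (Fin.cons y x : Fin (m + 1) → E) :
      MvPolynomial (Fin (m + 1)) L →ₐ[L] E) = Ideal.span {G} := by
    apply le_antisymm
    · intro p hp
      have hp : MvPolynomial.aeval (Fin.cons y x : Fin (m + 1) → E) p = 0 := hp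
      obtain ⟨r, P, hr, hP⟩ := exists_map_eq_smul (R := R) (L := L) p
      have hP' : MvPolynomial.map (algebraMap R L) P = algebraMap R L r • p := by
        rw [hP, algebraMap_smul]
      have hP0 : MvPolynomial.aeval (Fin.cons y x : Fin (m + 1) → E) P = 0 := by
        rw [← haevalmap, hP', map_smul, hp, smul_zero]
      have hPker : P ∈ RingHom.ker (MvPolynomial.aeval (Fin.cons y x : Fin (m + 1) → E) :
          MvPolynomial (Fin (m + 1)) R →ₐ[R] E) := hP0
      rw [hkerR, Ideal.mem_span_singleton] at hPker
      obtain ⟨Q, hQ⟩ := hPker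
      rw [Ideal.mem_span_singleton]
      refine ⟨(algebraMap R L r)⁻¹ • MvPolynomial.map (algebraMap R L) Q, ?_⟩
      have hr' : algebraMap R L r ≠ 0 := fun e => hr (IsFractionRing.injective R L (by rw [e, map_zero]))
      have : algebraMap R L r • p = G * MvPolynomial.map (algebraMap R L) Q := by
        rw [← hP', hQ, map_mul, hG]
      rw [mul_smul_comm, ← this, smul_smul, inv_mul_cancel₀ hr', one_smul]
    · rw [Ideal.span_le, Set.singleton_subset_iff, SetLike.mem_coe, RingHom.mem_ker]
      rw [hG, haevalmap]
      have : F ∈ Ideal.span {F} := Ideal.subset_span (Set.mem_singleton F)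
      rw [← hkerR] at this
      exact this
  -- degree and monicity
  have hd : 1 ≤ μ.natDegree := minpoly.natDegree_pos hyint
  -- absolute irreducibility: `(G)^σ` is prime
  have hGne : MvPolynomial.map (algebraMap L (AlgebraicClosure L)) G ≠ 0 := by
    intro h0
    have h1 : finSuccEquiv (AlgebraicClosure L) m
        (MvPolynomial.map (algebraMap L (AlgebraicClosure L)) G) = 0 := by rw [h0, map_zero]
    rw [finSuccEquiv_map, hG, finSuccEquiv_map, hFμ, Polynomial.map_map] at h1
    exact (hμm.map _).ne_zero h1
  have hprime : (Ideal.span {MvPolynomial.map (algebraMap L (AlgebraicClosure L)) G}).IsPrime := by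
    have h := isPrime_map_ker_aeval (algebraMap L (AlgebraicClosure L)) (Fin.cons y x : Fin (m + 1) → E) hrac
    rwa [hkerL, Ideal.map_span, Set.image_singleton] at h
  have habs : IsAbsIrreducible G :=
    ((Ideal.span_singleton_prime hGne).mp hprime).irreducible
  exact ⟨F, μ.natDegree, hd, hFμ ▸ hμm, by rw [hFμ], hkerR, hkerL, habs⟩

omit [IsDomain R] [IsIntegrallyClosed R] in
/-- Specialisations of the model stay monic of the same degree in `X₀`. [folklore] -/
theorem monic_finSuccEquiv_map {m : ℕ} {F : MvPolynomial (Fin (m + 1)) R} {d : ℕ}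
    (hFm : (finSuccEquiv R m F).Monic) (hFd : (finSuccEquiv R m F).natDegree = d)
    {k : Type*} [CommRing k] [Nontrivial k] (π : R →+* k) :
    (finSuccEquiv k m (MvPolynomial.map π F)).Monic ∧
      (finSuccEquiv k m (MvPolynomial.map π F)).natDegree = d := by
  rw [finSuccEquiv_map]
  exact ⟨hFm.map _, by rw [Polynomial.Monic.natDegree_map hFm, hFd]⟩

end TwoPointPencil

end Literature.AlgebraicGeometry.Motives

end
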